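import Summits.AtomisticToContinuum.Crystallization.Theorems.ShellCensus.Negative.MatchingDegree

/-!
# `ShellTrichotomy` (stmt-AtomisticToContinuum-18070), negative side I: the link-path obstruction

Witness-independent tool for the disprover / refuter lane of the crux `GappedShellCensus.ShellTrichotomy`
(all-degree-4 gapped twelve-shells are `1/5`-close to fcc or hcp):

* `triCorners P ρ a` — ordered pairs `(b, c)` of pattern points forming a `ρ`-triangle with `a`;
  `not_shellCloseTo_of_linkPath` — if every pattern point has `≤ 4` such corners (at most two bonded
  triangles through it) while the shell has a vertex with a bonded LINK PATH `n₀–n₁–n₂–n₃` (three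
  bonded triangles fanned at it, all seven edges `≤ β`) and `β + 2η < ρ`, the shell is not `η`-close to the
  pattern (an `η`-matching is injective and stretches distances by `≤ 2η`).  This is the degree-4
  analogue of `ShellCensusNegative.not_shellCloseTo_of_degree`: it separates the `3T`-fanned vertex
  words (`3T+Q`, `3T+P`, `3T+H`: every 4-regular 12-vertex plane map other than the cuboctahedron and the
  anticuboctahedron has one, by the medial-graph enumeration in the disprover's notes) from branch (A)
  whenever the fan's bonds are `< √2 − 2/5 = 1.0142`.
* `fcc_triCorners`, `hcp_triCorners` — every point of either pattern lies in exactly two bonded triangles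
  (`≤ 4` ordered corners within `1.414 < √2`; integer models, `decide`).
* `sqrt_div_le_iff`, `le_sqrt_div_iff` — two-sided versions of the `√q / D` transfer lemmas.

Negative-side support: nothing here concludes a route item positively.  Disprover seat
refuter-cdisprove-stmt-AtomisticToContinuum-18070-0, 2026-08-17.
-/

noncomputable section

namespace Summit.AtomisticToContinuum.Crystallization.Theorems.ShellTrichotomyNegative

open Literature.Geometry.DiscreteGeometry
open Summit.AtomisticToContinuum.Crystallization.Theorems.ShellCensusNegative


/-- The ordered "`ρ`-triangle corners" at a pattern point `a`: ordered pairs `(b, c)` of pattern points,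
distinct from `a` and from each other, with `ab`, `ac`, `bc` all `< ρ`. [folklore] -/
def triCorners (P : Finset (EuclideanSpace ℝ (Fin 3))) (ρ : ℝ) (a : (EuclideanSpace ℝ (Fin 3))) : Finset ((EuclideanSpace ℝ (Fin 3)) × (EuclideanSpace ℝ (Fin 3))) :=
  (P ×ˢ P).filter fun bc => bc.1 ≠ a ∧ bc.2 ≠ a ∧ bc.1 ≠ bc.2 ∧ dist a bc.1 < ρ ∧ dist a bc.2 < ρ ∧ dist bc.1 bc.2 < ρ

/-- the six ordered index pairs along the path `0–1–2–3` [folklore] -/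
def pathPairs : Finset (Fin 4 × Fin 4) := {(0, 1), (1, 0), (1, 2), (2, 1), (2, 3), (3, 2)}

/-- six index pairs. [folklore] -/
theorem card_pathPairs : pathPairs.card = 6 := by decide

/-- THE LINK-PATH OBSTRUCTION. If every point `a` of the pattern `P` has at most four ordered
`ρ`-triangle corners (i.e. lies in at most two bonded triangles), while the shell `T` has a point `t0`
with four distinct other shell points `n 0, …, n 3` within `β` of it and `n 0 n 1`, `n 1 n 2`, `n 2 n 3`
within `β` (three bonded triangles fanned at `t0`), and `β + 2η < ρ`, then `T` is not `η`-close to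
`P`: an `η`-matching moves points by `≤ η`, hence is injective and stretches distances by `≤ 2η`,
so it would produce six ordered `ρ`-triangle corners at the image of `t0`. [folklore] -/
theorem not_shellCloseTo_of_linkPath {η β ρ : ℝ} {T P : Finset (EuclideanSpace ℝ (Fin 3))}
    (hP : ∀ a ∈ P, (triCorners P ρ a).card ≤ 4) (hβ : β + 2 * η < ρ)
    {t0 : (EuclideanSpace ℝ (Fin 3))} (ht0 : t0 ∈ T) (n : Fin 4 → (EuclideanSpace ℝ (Fin 3))) (hnT : ∀ i, n i ∈ T) (hninj : Function.Injective n)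
    (hn0 : ∀ i, n i ≠ t0) (hd0 : ∀ i, dist t0 (n i) ≤ β)
    (h01 : dist (n 0) (n 1) ≤ β) (h12 : dist (n 1) (n 2) ≤ β) (h23 : dist (n 2) (n 3) ≤ β) :
    ¬ ShellCloseTo η T P := by
  classical
  rintro ⟨A, hA⟩
  obtain ⟨f, hfQ, hfinj, hfd⟩ := exists_map_of_etaMatched hA
  -- the image point and its pattern preimage
  obtain ⟨a, ha, hfa⟩ := Finset.mem_image.1 (hfQ t0 ht0)
  -- distances after the matching
  have hstretch : ∀ x ∈ T, ∀ y ∈ T, dist x y ≤ β → dist (f x) (f y) < ρ := by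
    intro x hx y hy hxy
    calc dist (f x) (f y) ≤ dist (f x) x + dist x y + dist y (f y) := dist_triangle4 _ _ _ _
      _ ≤ η + β + η := by
          gcongr
          · rw [dist_comm]; exact hfd x hx
          · exact hfd y hy
      _ < ρ := by linarith
  have hη0 : 0 ≤ η := le_trans dist_nonneg (hfd t0 ht0)
  -- g = f ∘ n is injective
  have hg : Function.Injective (fun i => f (n i)) := fun i j h => hninj (hfinj _ (hnT i) _ (hnT j) h)
  have hgne : ∀ i, f (n i) ≠ f t0 := fun i h => hn0 i (hfinj _ (hnT i) _ ht0 h)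
  -- six ordered corners at f t0, inside the image pattern A '' P
  let S : Finset ((EuclideanSpace ℝ (Fin 3)) × (EuclideanSpace ℝ (Fin 3))) := pathPairs.image fun ij => (f (n ij.1), f (n ij.2))
  have hScard : S.card = 6 := by
    rw [Finset.card_image_of_injective _ ?_, card_pathPairs]
    intro ij kl h
    simp only [Prod.mk.injEq] at h
    exact Prod.ext (hg h.1) (hg h.2)
  have hSsub : S ⊆ triCorners (P.image A) ρ (f t0) := by
    intro bc hbc
    obtain ⟨ij, hij, rfl⟩ := Finset.mem_image.1 hbc
    have hcases : dist (n ij.1) (n ij.2) ≤ β ∧ ij.1 ≠ ij.2 := by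
      simp only [pathPairs, Finset.mem_insert, Finset.mem_singleton] at hij
      rcases hij with h | h | h | h | h | h <;> subst h <;> simp [h01, h12, h23, dist_comm (n 1) (n 0), dist_comm (n 2) (n 1), dist_comm (n 3) (n 2)]
    simp only [triCorners, Finset.mem_filter, Finset.mem_product]
    refine ⟨⟨hfQ _ (hnT _), hfQ _ (hnT _)⟩, hgne _, hgne _, fun h => hcases.2 (hg h), ?_, ?_, ?_⟩
    · exact hstretch _ ht0 _ (hnT _) (hd0 _)
    · exact hstretch _ ht0 _ (hnT _) (hd0 _)
    · exact hstretch _ (hnT _) _ (hnT _) hcases.1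
  have h6 : 6 ≤ (triCorners (P.image A) ρ (f t0)).card := hScard ▸ Finset.card_le_card hSsub
  -- invariance of the corner count under the isometry
  have hinv : (triCorners (P.image A) ρ (A a)).card = (triCorners P ρ a).card := by
    unfold triCorners
    rw [← Finset.prodMap_image_product, Finset.filter_image,
      Finset.card_image_of_injective _ (A.injective.prodMap A.injective)]
    congr 1
    apply Finset.filter_congr
    intro bc _
    simp [A.injective.ne_iff, LinearIsometry.dist_map]
  rw [← hfa, hinv] at h6
  have := hP a ha
  omega

/-! ### pattern facts: at most two bonded triangles at every point of fcc / hcp -/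

/-- integer version of `triCorners` [folklore] -/
def triCornersInt (S : Finset (Fin 3 → ℤ)) (M : ℤ) (a : Fin 3 → ℤ) : Finset ((Fin 3 → ℤ) × (Fin 3 → ℤ)) :=
  (S ×ˢ S).filter fun bc => bc.1 ≠ a ∧ bc.2 ≠ a ∧ bc.1 ≠ bc.2 ∧ sqNormInt (a - bc.1) < M ∧ sqNormInt (a - bc.2) < M ∧ sqNormInt (bc.1 - bc.2) < M

/-- fcc integer model: every vector lies in exactly two bonded triangles (four ordered corners with all
three squared distances `< 4 = (√2·√2)²`). [cite: ConwaySloane1999, Ch. 4 §6.3] -/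
theorem fccInt_triCorners : ∀ a ∈ fccInt, (triCornersInt fccInt 4 a).card ≤ 4 := by decide

/-- hcp integer model (scale `√18`): at most four ordered corners with squared distances `< 36`. [folklore] -/
theorem hcpInt_triCorners : ∀ a ∈ hcpInt, (triCornersInt hcpInt 36 a).card ≤ 4 := by decide


/-- the distance test on a `√N`-scaled integer pattern, in integers (extracted from
`card_near_scaledPattern_le`). [folklore] -/
theorem sqNormInt_lt_of_dist_scaled_lt {N : ℕ} (hN : N ≠ 0) {M : ℤ} {ρ : ℝ} (hρ : ρ ^ 2 * N ≤ M)
    (v w : Fin 3 → ℤ) (hd : dist ((Real.sqrt N)⁻¹ • intVec v : (EuclideanSpace ℝ (Fin 3))) ((Real.sqrt N)⁻¹ • intVec w) < ρ) :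
    sqNormInt (v - w) < M := by
  have hNpos : (0 : ℝ) < N := by exact_mod_cast Nat.pos_of_ne_zero hN
  have hc : (0 : ℝ) ≤ (Real.sqrt N)⁻¹ := by positivity
  rw [dist_scaled_intVec _ hc] at hd
  have hsN : 0 < Real.sqrt N := Real.sqrt_pos.2 hNpos
  rw [inv_mul_lt_iff₀ hsN] at hd
  have h2 : (sqNormInt (v - w) : ℝ) < (Real.sqrt N * ρ) ^ 2 := by
    by_contra hcon
    push Not at hcon
    have : Real.sqrt N * ρ ≤ Real.sqrt (sqNormInt (v - w) : ℝ) := by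
      calc Real.sqrt N * ρ = Real.sqrt ((Real.sqrt N * ρ) ^ 2) := by
            rw [Real.sqrt_sq (by nlinarith [Real.sqrt_nonneg (sqNormInt (v - w) : ℝ)])]
        _ ≤ _ := Real.sqrt_le_sqrt hcon
    linarith
  rw [mul_pow, Real.sq_sqrt hNpos.le, mul_comm] at h2
  have h3 : (sqNormInt (v - w) : ℝ) < (M : ℝ) := lt_of_lt_of_le h2 hρ
  exact_mod_cast h3

/-- Transfer of the corner count from the integer model to the scaled pattern. [folklore] -/
theorem triCorners_scaledPattern_le {S : Finset (Fin 3 → ℤ)} {N : ℕ} (hN : N ≠ 0) {M : ℤ}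
    (hS : ∀ v ∈ S, (triCornersInt S M v).card ≤ 4) {ρ : ℝ} (hρ : ρ ^ 2 * N ≤ M) :
    ∀ a ∈ scaledPattern S N, (triCorners (scaledPattern S N) ρ a).card ≤ 4 := by
  classical
  intro a ha
  obtain ⟨v, hv, rfl⟩ := Finset.mem_image.1 ha
  have hinj := scaledPattern_map_injective (N := N) hN
  unfold triCorners scaledPattern
  rw [← Finset.prodMap_image_product, Finset.filter_image,
    Finset.card_image_of_injective _ (hinj.prodMap hinj)]
  refine le_trans (Finset.card_le_card ?_) (hS v hv)
  intro bc hbc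
  simp only [triCornersInt, Finset.mem_filter, Finset.mem_product, Prod.map_fst, Prod.map_snd] at hbc ⊢
  obtain ⟨hmem, h1, h2, h12, d1, d2, d12⟩ := hbc
  refine ⟨hmem, fun h => h1 (by rw [h]), fun h => h2 (by rw [h]), fun h => h12 (by rw [h]), ?_, ?_, ?_⟩
  · exact sqNormInt_lt_of_dist_scaled_lt hN hρ _ _ d1
  · exact sqNormInt_lt_of_dist_scaled_lt hN hρ _ _ d2
  · exact sqNormInt_lt_of_dist_scaled_lt hN hρ _ _ d12

/-- Every point of the fcc pattern lies in at most two bonded triangles: at most four ordered corners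
`(b, c)` with `ab, ac, bc < 1.414 (< √2)`. [cite: HalesDSP2012, §1.3 (cuboctahedron)] -/
theorem fcc_triCorners : ∀ a ∈ fccKissingPattern, (triCorners fccKissingPattern 1.414 a).card ≤ 4 :=
  triCorners_scaledPattern_le two_ne_zero fccInt_triCorners (by norm_num)

/-- Every point of the hcp pattern lies in at most two bonded triangles. [cite: HalesDSP2012, §1.3 (anticuboctahedron)] -/
theorem hcp_triCorners : ∀ a ∈ hcpKissingPattern, (triCorners hcpKissingPattern 1.414 a).card ≤ 4 :=
  triCorners_scaledPattern_le (by norm_num) hcpInt_triCorners (by norm_num)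

/-! ### `√q / D` versus integer bounds (two-sided versions of `le_sqrt_div` / `sqrt_div_le`) -/

/-- `√q / D ≤ hi ↔ q ≤ (hi·D)²`. [folklore] -/
theorem sqrt_div_le_iff {D : ℕ} (hD : D ≠ 0) {q hi : ℝ} (hq : 0 ≤ q) (hhi : 0 ≤ hi) :
    Real.sqrt q / D ≤ hi ↔ q ≤ (hi * D) ^ 2 := by
  have hDpos : (0 : ℝ) < D := by exact_mod_cast Nat.pos_of_ne_zero hD
  rw [div_le_iff₀ hDpos]
  constructor
  · intro h
    calc q = (Real.sqrt q) ^ 2 := (Real.sq_sqrt hq).symm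
      _ ≤ (hi * D) ^ 2 := by gcongr
  · intro h
    calc Real.sqrt q ≤ Real.sqrt ((hi * D) ^ 2) := Real.sqrt_le_sqrt h
      _ = hi * D := Real.sqrt_sq (by positivity)

/-- `lo ≤ √q / D ↔ (lo·D)² ≤ q`. [folklore] -/
theorem le_sqrt_div_iff {D : ℕ} (hD : D ≠ 0) {q lo : ℝ} (hq : 0 ≤ q) (hlo : 0 ≤ lo) :
    lo ≤ Real.sqrt q / D ↔ (lo * D) ^ 2 ≤ q := by
  have hDpos : (0 : ℝ) < D := by exact_mod_cast Nat.pos_of_ne_zero hD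
  rw [le_div_iff₀ hDpos]
  constructor
  · intro h
    calc (lo * D) ^ 2 ≤ (Real.sqrt q) ^ 2 := by gcongr
      _ = q := Real.sq_sqrt hq
  · intro h
    calc lo * D = Real.sqrt ((lo * D) ^ 2) := (Real.sqrt_sq (by positivity)).symm
      _ ≤ Real.sqrt q := Real.sqrt_le_sqrt h


end Summit.AtomisticToContinuum.Crystallization.Theorems.ShellTrichotomyNegative

end
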